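import Mathlib
import HarnessLib
import Summits.CriticalPhenomena.CardyFormulaZ2.Theses.CardyStressTensorWard

/-!
# Crux `HadamardRegularity` (stmt-CriticalPhenomena-4567) — line `hadamard-split`

Skeleton of the typed decomposition (crux-strategist unit `cstrat-stmt-CriticalPhenomena-4567-r1`, BC2 redirect
of the 2026-08-17 route re-audit) of the crux `HadamardRegularity` of route
`route-CriticalPhenomena-CardyStressTensorWard` — Hadamard differentiability of the crossing limit
`Λ = limUnder (𝓝[>] 0) (bondDomainCrossingProb ·)` along `C²` ambient deformations `id + εV`, with an `ℝ`-linear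
derivative bounded in the `C¹(ball ⊇ R̄)` seminorm — into four LATTICE-LEVEL stubs (= the four split children,
stated verbatim over Literature vocabulary):

* `stub_deformationLipschitz`   — a-priori, mesh-uniform Lipschitz bound for crossing probabilities under
  `C²`-small deformations, in the `C¹(ball)` seminorm (up-to-constants boundary 3-arm / 2-arm technology);
* `stub_localizedVariation`     — bumps supported in `ρ(R)`-balls have an asymptotic (mesh-uniform) first
  variation (the sharp boundary-response bet: one boundary spot or one marked point at a time);
* `stub_variationSuperposition` — asymptotic first variations add under superposition of deformation fields;
* `stub_deformationLimits`      — crossing limits exist along the deformation families (`LimitExists`, item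
  stmt-CriticalPhenomena-0747, read along the families; one line from it).

`HadamardRegularity_of : HadamardRegularity` applies the sorry-free composition lemma `hadamardRegularity_of_pieces`
(stubs ⟹ the crux body) to the four stubs. The composition is genuine analysis, not a
conjunction seam: localisation of an arbitrary admissible field by a smooth partition of unity subordinate to
`ρ`-balls on a ball containing `R̄` (families are quantified by their germ on `closure R.carrier`, on which
`MarkedDomain.map` only depends: `map_congr`), superposition by induction over the pieces, homogeneity by
reparametrising the deformation parameter, uniqueness of asymptotic derivatives (the homeomorphisms
`z ↦ z + εV z` are built by the contraction principle), the `C¹` bound from the Lipschitz stub, extension to an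
`ℝ`-linear functional on all of `ℂ → ℂ` (`LinearMap.exists_extend`), and the interchange "mesh limit, then
`ε → 0`" through `stub_deformationLimits`. The same proof, packaged for
`Theorems/CardyStressTensorWardHadamardRegularitySplit.lean` (theorem `hadamardRegularity_of_subs`), is attached
to the item as a candidate proof (planners cannot write `Theorems/`, D-0016).
-/

noncomputable section

set_option linter.dupNamespace false

namespace Summit.CriticalPhenomena.CardyFormulaZ2.Cruxes.HadamardRegularity.HadamardSplit

open scoped Topology NNReal Manifold ContDiff
open Filter Set Function Metric
open Literature.Probability.Percolation Literature.Probability.RandomPlanarGeometry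

/-! ### The four stubs (= the split children, verbatim) -/

/-- Stub 1 (= child `DeformationLipschitz`, crux): a-priori, mesh-uniform Lipschitz bound for the crossing
probabilities of `R.map (Φ ε)` in `ε`, in the `C¹(closedBall 0 r)` seminorm of the field, `r` with
`R̄ ⊆ ball 0 r`. Mechanism: boundary 3-arm exponent 2 / 2-arm exponent 1 up to constants (Nolin 2008 Thm 23)
and a boundary-strip union bound. -/
theorem stub_deformationLipschitz :
    (open Literature.Probability.Percolation Literature.Probability.LatticeModels Literature.Probability.RandomPlanarGeometry in ∀ R : ConformalRectangle, ∃ C r : ℝ, closure R.carrier ⊆ Metric.ball (0:ℂ) r ∧ ∀ V : ℂ → ℂ, ContDiff ℝ 2 V → (∃ B : ℝ, ∀ z : ℂ, ‖V z‖ ≤ B * (1 + ‖z‖) ∧ ‖fderiv ℝ V z‖ ≤ B) → ∀ Φ : ℝ → ℂ ≃ₜ ℂ, (∀ᶠ ε in 𝓝 (0:ℝ), ∀ z ∈ closure R.carrier, Φ ε z = z + (ε : ℂ) * V z) → ∀ᶠ ε in 𝓝 (0:ℝ), ∀ᶠ δ in 𝓝[>] (0:ℝ), |bondDomainCrossingProb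 (R.map (Φ ε)) δ - bondDomainCrossingProb (R.map (Φ 0)) δ| ≤ C * |ε| * sSup ((fun z : ℂ => ‖V z‖ + ‖fderiv ℝ V z‖) '' Metric.closedBall (0:ℂ) r)) := by
  sorry

/-- Stub 2 (= child `LocalizedVariation`, crux, the bet): for some `ρ = ρ(R) > 0`, every admissible field
supported in a `ρ`-ball has an asymptotic (mesh-uniform, junk-free) first variation along every family with
germ `id + εV` on `R̄` — the sharp first-order boundary response at ONE boundary spot / ONE marked point. -/
theorem stub_localizedVariation :
    (open Literature.Probability.Percolation Literature.Probability.LatticeModels Literature.Probability.RandomPlanarGeometry in ∀ R : ConformalRectangle, ∃ ρ : ℝ, 0 < ρ ∧ ∀ (z₀ : ℂ) (V : ℂ → ℂ), ContDiff ℝ 2 V → (∃ B : ℝ, ∀ z : ℂ, ‖V z‖ ≤ B * (1 + ‖z‖) ∧ ‖fderiv ℝ V z‖ ≤ B) → tsupport V ⊆ Metric.ball z₀ ρ → ∃ L : ℝ, ∀ Φ : ℝ → ℂ ≃ₜ ℂ, (∀ᶠ ε in 𝓝 (0:ℝ), ∀ z ∈ closure R.carrier, Φ ε z = z + (ε : ℂ)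 * V z) → ∀ η : ℝ, 0 < η → ∀ᶠ ε in 𝓝 (0:ℝ), ∀ᶠ δ in 𝓝[>] (0:ℝ), |bondDomainCrossingProb (R.map (Φ ε)) δ - bondDomainCrossingProb (R.map (Φ 0)) δ - ε * L| ≤ η * |ε|) := by
  sorry

/-- Stub 3 (= child `VariationSuperposition`, crux): asymptotic first variations add under superposition of
the deformation fields (no conical singularity of the crossing functional on the space of domains). -/
theorem stub_variationSuperposition :
    (open Literature.Probability.Percolation Literature.Probability.LatticeModels Literature.Probability.RandomPlanarGeometry in ∀ (R : ConformalRectangle) (V W : ℂ → ℂ) (L M : ℝ), ContDiff ℝ 2 V → (∃ B : ℝ, ∀ z : ℂ, ‖V z‖ ≤ B * (1 + ‖z‖) ∧ ‖fderiv ℝ V z‖ ≤ B) → ContDiff ℝ 2 W → (∃ B : ℝ, ∀ z : ℂ, ‖W z‖ ≤ B * (1 + ‖z‖) ∧ ‖fderiv ℝ W z‖ ≤ B) → (∀ Φ : ℝ → ℂ ≃ₜ ℂ, (∀ᶠ ε in 𝓝 (0:ℝ), ∀ z ∈ closure R.carrier, Φ ε z = z + (ε : ℂ) * V z) → ∀ η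 : ℝ, 0 < η → ∀ᶠ ε in 𝓝 (0:ℝ), ∀ᶠ δ in 𝓝[>] (0:ℝ), |bondDomainCrossingProb (R.map (Φ ε)) δ - bondDomainCrossingProb (R.map (Φ 0)) δ - ε * L| ≤ η * |ε|) → (∀ Φ : ℝ → ℂ ≃ₜ ℂ, (∀ᶠ ε in 𝓝 (0:ℝ), ∀ z ∈ closure R.carrier, Φ ε z = z + (ε : ℂ) * W z) → ∀ η : ℝ, 0 < η → ∀ᶠ ε in 𝓝 (0:ℝ), ∀ᶠ δ in 𝓝[>] (0:ℝ), |bondDomainCrossingProb (R.map (Φ ε)) δ - bondDomainCrossingProb (R.map (Φ 0)) δ - ε * M| ≤ η * |ε|) → ∀ Φ : ℝ → ℂ ≃ₜ ℂ, (∀ᶠ ε in 𝓝 (0:ℝ), ∀ z ∈ closure R.carrier, Φ ε z = z + (ε : ℂ) * (V z + W z)) → ∀ η : ℝ, 0 < η → ∀ᶠ ε in 𝓝 (0:ℝ), ∀ᶠ δ in 𝓝[>] (0:ℝ), |bondDomainCrossingProb (R.map (Φ ε)) δ - bondDomainCrossingProb (R.map (Φ 0)) δ - ε * (L + M)| ≤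 η * |ε|) := by
  sorry

/-- Stub 4 (= child `DeformationLimits`, support): crossing limits exist along the deformation families — the
route's support item `LimitExists` (stmt-CriticalPhenomena-0747) read along the families (one line from it:
`fun h R _ _ _ Φ _ => Filter.Eventually.of_forall fun ε => h (R.map (Φ ε))`). -/
theorem stub_deformationLimits :
    (open Literature.Probability.Percolation Literature.Probability.LatticeModels Literature.Probability.RandomPlanarGeometry in ∀ (R : ConformalRectangle) (V : ℂ → ℂ), ContDiff ℝ 2 V → (∃ B : ℝ, ∀ z : ℂ, ‖V z‖ ≤ B * (1 + ‖z‖) ∧ ‖fderiv ℝ V z‖ ≤ B) → ∀ Φ : ℝ → ℂ ≃ₜ ℂ, (∀ᶠ ε in 𝓝 (0:ℝ), ∀ z ∈ closure R.carrier, Φ ε z = z + (ε : ℂ) * V z) → ∀ᶠ ε in 𝓝 (0:ℝ), ∃ Λ : ℝ, Tendsto (bondDomainCrossingProb (R.map (Φ ε))) (𝓝[>] 0) (𝓝 Λ)) := by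
  sorry

/-! ### §0 Vocabulary (data-valued helpers) -/

/-- The admissible deformation fields of `HadamardRegularity` — `C²` fields of linear growth with bounded
derivative — as an `ℝ`-submodule of `ℂ → ℂ`. [folklore] -/
def niceSub : Submodule ℝ (ℂ → ℂ) where
  carrier := {V | ContDiff ℝ 2 V ∧ ∃ B : ℝ, ∀ z : ℂ, ‖V z‖ ≤ B * (1 + ‖z‖) ∧ ‖fderiv ℝ V z‖ ≤ B}
  add_mem' := by
    rintro V W ⟨hV, B, hB⟩ ⟨hW, B', hB'⟩
    have hdV : Differentiable ℝ V := hV.differentiable (by norm_num)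
    have hdW : Differentiable ℝ W := hW.differentiable (by norm_num)
    refine ⟨hV.add hW, B + B', fun z => ⟨?_, ?_⟩⟩
    · calc ‖(V + W) z‖ = ‖V z + W z‖ := rfl
        _ ≤ ‖V z‖ + ‖W z‖ := norm_add_le _ _
        _ ≤ B * (1 + ‖z‖) + B' * (1 + ‖z‖) := add_le_add (hB z).1 (hB' z).1
        _ = (B + B') * (1 + ‖z‖) := by ring
    · have h : fderiv ℝ (V + W) z = fderiv ℝ V z + fderiv ℝ W z :=
        fderiv_add (hdV z) (hdW z)
      rw [h]
      exact (norm_add_le _ _).trans (add_le_add (hB z).2 (hB' z).2)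
  zero_mem' := by
    refine ⟨contDiff_const, 0, fun z => ⟨by simp, ?_⟩⟩
    simp
  smul_mem' := by
    rintro c V ⟨hV, B, hB⟩
    have hdV : Differentiable ℝ V := hV.differentiable (by norm_num)
    refine ⟨hV.const_smul c, ‖c‖ * B, fun z => ⟨?_, ?_⟩⟩
    · calc ‖(c • V) z‖ = ‖c‖ * ‖V z‖ := by simp
        _ ≤ ‖c‖ * (B * (1 + ‖z‖)) := mul_le_mul_of_nonneg_left (hB z).1 (norm_nonneg _)
        _ = ‖c‖ * B * (1 + ‖z‖) := by ring
    · have h : fderiv ℝ (c • V) z = c • fderiv ℝ V z := fderiv_const_smul (hdV z) c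
      rw [h, norm_smul]
      exact mul_le_mul_of_nonneg_left (hB z).2 (norm_nonneg _)

/-- Families of plane homeomorphisms whose germ at `ε = 0` deforms `R̄` by `id + εV` (only the values on
`closure R.carrier` matter for `R.map`). [folklore] -/
def famSet (R : ConformalRectangle) (V : ℂ → ℂ) : Set (ℝ → ℂ ≃ₜ ℂ) :=
  {Φ | ∀ᶠ ε in 𝓝 (0:ℝ), ∀ z ∈ closure R.carrier, Φ ε z = z + (ε : ℂ) * V z}

/-- Asymptotic (mesh-uniform) first variations of the crossing probability along a family `Φ`. [folklore] -/
def aderivSet (R : ConformalRectangle) (Φ : ℝ → ℂ ≃ₜ ℂ) : Set ℝ :=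
  {L | ∀ η : ℝ, 0 < η → ∀ᶠ ε in 𝓝 (0:ℝ), ∀ᶠ δ in 𝓝[>] (0:ℝ),
    |bondDomainCrossingProb (R.map (Φ ε)) δ - bondDomainCrossingProb (R.map (Φ 0)) δ - ε * L| ≤ η * |ε|}

/-- Asymptotic first variations of the crossing probability of `R` along the field `V`: along EVERY family
with germ `id + εV` on `R̄`. [folklore] -/
def hasVarSet (R : ConformalRectangle) (V : ℂ → ℂ) : Set ℝ :=
  {L | ∀ Φ ∈ famSet R V, L ∈ aderivSet R Φ}

/-! ### §1 The image marked domain depends only on the homeomorphism on the closure -/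

theorem jordanDomain_eq {D E : JordanDomain} (hc : D.carrier = E.carrier) (hb : D.boundary = E.boundary) :
    D = E := by
  obtain ⟨c, b, _, _, _, _, _, _, _⟩ := D
  obtain ⟨c', b', _, _, _, _, _, _, _⟩ := E
  simp only at hc hb
  subst hc
  subst hb
  rfl

theorem markedDomain_eq {n : ℕ} {D E : MarkedDomain n} (h : D.toJordanDomain = E.toJordanDomain)
    (hm : D.mark = E.mark) : D = E := by
  obtain ⟨J, m, _, _⟩ := D
  obtain ⟨J', m', _, _⟩ := E
  simp only at h hm
  subst h
  subst hm
  rfl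

/-- `R.map φ` depends only on `φ` restricted to `closure R.carrier` (carrier image and boundary loop). [folklore] -/
theorem map_congr (R : ConformalRectangle) {φ ψ : ℂ ≃ₜ ℂ} (h : ∀ z ∈ closure R.carrier, φ z = ψ z) :
    R.map φ = R.map ψ := by
  refine markedDomain_eq (jordanDomain_eq ?_ ?_) rfl
  · show φ '' R.carrier = ψ '' R.carrier
    exact image_congr fun z hz => h z (subset_closure hz)
  · show (φ : ℂ → ℂ) ∘ R.boundary = ψ ∘ R.boundary
    funext t
    exact h _ (by rw [R.toJordanDomain.closure_eq]; exact Or.inr (mem_range_self t))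

/-! ### §2 The homeomorphisms `z ↦ z + ε V z` (contraction principle) -/

theorem lipschitz_of_mem {V : ℂ → ℂ} (hV : V ∈ niceSub) : ∃ K : ℝ≥0, LipschitzWith K V := by
  obtain ⟨hV, B, hB⟩ := hV
  refine ⟨B.toNNReal, lipschitzWith_of_nnnorm_fderiv_le (hV.differentiable (by norm_num)) fun z => ?_⟩
  rw [← NNReal.coe_le_coe, coe_nnnorm]
  exact (hB z).2.trans (Real.le_coe_toNNReal B)

theorem perturb_inverse {V : ℂ → ℂ} {K : ℝ≥0} (hV : LipschitzWith K V) {ε : ℝ} (hε : |ε| * K ≤ 1 / 2) :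
    ∃ g : ℂ → ℂ, LipschitzWith 2 g ∧ Function.LeftInverse g (fun z => z + (ε:ℂ) * V z) ∧
      Function.RightInverse g (fun z => z + (ε:ℂ) * V z) := by
  -- `T y x = y - ε V x` is a contraction for every `y`
  have hT : ∀ y : ℂ, ContractingWith (‖ε‖₊ * K) (fun x => y - (ε:ℂ) * V x) := by
    intro y
    refine ⟨?_, LipschitzWith.of_dist_le_mul fun a b => ?_⟩
    · rw [← NNReal.coe_lt_coe, NNReal.coe_mul, coe_nnnorm, Real.norm_eq_abs]
      push_cast
      linarith
    · have h1 := hV.dist_le_mul a b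
      rw [dist_eq_norm, dist_eq_norm] at *
      calc ‖y - (ε:ℂ) * V a - (y - (ε:ℂ) * V b)‖ = ‖(ε:ℂ) * (V b - V a)‖ := by ring_nf
        _ = |ε| * ‖V a - V b‖ := by rw [norm_mul, Complex.norm_real, Real.norm_eq_abs, norm_sub_rev]
        _ ≤ |ε| * (K * ‖a - b‖) := mul_le_mul_of_nonneg_left h1 (abs_nonneg _)
        _ = (‖ε‖₊ * K : ℝ≥0) * ‖a - b‖ := by push_cast; rw [Real.norm_eq_abs]; ring
  set g : ℂ → ℂ := fun y => ContractingWith.fixedPoint _ (hT y) with hg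
  have hfix : ∀ y, y - (ε:ℂ) * V (g y) = g y := fun y => ContractingWith.fixedPoint_isFixedPt (hT y)
  have hεK : |ε| * K ≤ 1 / 2 := hε
  refine ⟨g, LipschitzWith.of_dist_le_mul fun y y' => ?_, fun x => ?_, fun y => ?_⟩
  · have h1 := hV.dist_le_mul (g y) (g y')
    rw [dist_eq_norm, dist_eq_norm] at *
    have h2 : g y - g y' = (y - y') - (ε:ℂ) * (V (g y) - V (g y')) := by
      linear_combination (-1 : ℂ) * hfix y + hfix y'
    have h3 : ‖g y - g y'‖ ≤ ‖y - y'‖ + |ε| * (K * ‖g y - g y'‖) := by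
      calc ‖g y - g y'‖ = ‖(y - y') - (ε:ℂ) * (V (g y) - V (g y'))‖ := by rw [h2]
        _ ≤ ‖y - y'‖ + ‖(ε:ℂ) * (V (g y) - V (g y'))‖ := norm_sub_le _ _
        _ ≤ ‖y - y'‖ + |ε| * (K * ‖g y - g y'‖) := by
          refine add_le_add le_rfl ?_
          rw [norm_mul, Complex.norm_real, Real.norm_eq_abs]
          exact mul_le_mul_of_nonneg_left h1 (abs_nonneg _)
    have h4 : |ε| * (K * ‖g y - g y'‖) ≤ (1 / 2) * ‖g y - g y'‖ := by
      rw [← mul_assoc]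
      exact mul_le_mul_of_nonneg_right hεK (norm_nonneg _)
    push_cast
    linarith
  · -- `x` is a fixed point of `T (x + ε V x)`
    symm
    refine ContractingWith.fixedPoint_unique (hT (x + (ε:ℂ) * V x)) ?_
    show x + (ε:ℂ) * V x - (ε:ℂ) * V x = x
    ring
  · show g y + (ε:ℂ) * V (g y) = y
    have := hfix y
    linear_combination (-1 : ℂ) * this

/-- The homeomorphism `z ↦ z + ε V z` of the plane, for `V` `K`-Lipschitz and `|ε| K ≤ 1/2`. [folklore] -/
def perturbHomeomorph {V : ℂ → ℂ} {K : ℝ≥0} (hV : LipschitzWith K V) {ε : ℝ} (hε : |ε| * K ≤ 1 / 2) :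
    ℂ ≃ₜ ℂ where
  toFun z := z + (ε:ℂ) * V z
  invFun := (perturb_inverse hV hε).choose
  left_inv := (perturb_inverse hV hε).choose_spec.2.1
  right_inv := (perturb_inverse hV hε).choose_spec.2.2
  continuous_toFun := continuous_id.add (continuous_const.mul hV.continuous)
  continuous_invFun := (perturb_inverse hV hε).choose_spec.1.continuous

/-- Every admissible field generates a family of plane homeomorphisms equal to `id + εV` near `ε = 0`. [folklore] -/
theorem exists_family {V : ℂ → ℂ} (hV : V ∈ niceSub) :
    ∃ Φ : ℝ → ℂ ≃ₜ ℂ, ∀ᶠ ε in 𝓝 (0:ℝ), ∀ z : ℂ, Φ ε z = z + (ε:ℂ) * V z := by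
  classical
  obtain ⟨K, hK⟩ := lipschitz_of_mem hV
  refine ⟨fun ε => if h : |ε| * K ≤ 1 / 2 then perturbHomeomorph hK h else Homeomorph.refl ℂ, ?_⟩
  have hc : Continuous (fun ε : ℝ => |ε| * (K:ℝ)) := by fun_prop
  have ht : Tendsto (fun ε : ℝ => |ε| * (K:ℝ)) (𝓝 0) (𝓝 0) := by simpa using hc.tendsto 0
  have hev : ∀ᶠ ε in 𝓝 (0:ℝ), |ε| * (K:ℝ) ≤ 1 / 2 :=
    (ht.eventually (eventually_lt_nhds (by norm_num : (0:ℝ) < 1 / 2))).mono fun ε h => h.le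
  filter_upwards [hev] with ε hε z
  simp only [dif_pos hε]
  rfl

theorem mem_famSet_of_forall {R : ConformalRectangle} {V : ℂ → ℂ} {Φ : ℝ → ℂ ≃ₜ ℂ}
    (h : ∀ᶠ ε in 𝓝 (0:ℝ), ∀ z : ℂ, Φ ε z = z + (ε:ℂ) * V z) : Φ ∈ famSet R V :=
  h.mono fun _ hε z _ => hε z

/-! ### §3 Calculus of asymptotic first variations -/

/-- The zero field has asymptotic first variation `0` (the image domain does not move). [folklore] -/
theorem zero_mem_hasVarSet (R : ConformalRectangle) : (0:ℝ) ∈ hasVarSet R 0 := by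
  intro Φ hΦ η hη
  have h0 : ∀ z ∈ closure R.carrier, Φ 0 z = z + ((0:ℝ) : ℂ) * (0 : ℂ → ℂ) z := hΦ.self_of_nhds
  filter_upwards [hΦ] with ε hε
  have hmap : R.map (Φ ε) = R.map (Φ 0) :=
    map_congr R fun z hz => by rw [hε z hz, h0 z hz]; simp
  refine Filter.Eventually.of_forall fun δ => ?_
  rw [hmap]
  have : 0 ≤ η * |ε| := by positivity
  simpa using this

/-- Along a fixed family the asymptotic first variation is unique. [folklore] -/
theorem eq_of_mem_aderivSet {R : ConformalRectangle} {Φ : ℝ → ℂ ≃ₜ ℂ} {L L' : ℝ}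
    (hL : L ∈ aderivSet R Φ) (hL' : L' ∈ aderivSet R Φ) : L = L' := by
  by_contra hne
  have hpos : 0 < |L - L'| := abs_pos.2 (sub_ne_zero.2 hne)
  have hη0 : 0 < |L - L'| / 4 := by positivity
  have h3 : ∀ᶠ ε in 𝓝[≠] (0:ℝ),
      ((∀ᶠ δ in 𝓝[>] (0:ℝ), |bondDomainCrossingProb (R.map (Φ ε)) δ -
          bondDomainCrossingProb (R.map (Φ 0)) δ - ε * L| ≤ |L - L'| / 4 * |ε|) ∧
        (∀ᶠ δ in 𝓝[>] (0:ℝ), |bondDomainCrossingProb (R.map (Φ ε)) δ -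
          bondDomainCrossingProb (R.map (Φ 0)) δ - ε * L'| ≤ |L - L'| / 4 * |ε|)) ∧ ε ∈ ({0}ᶜ : Set ℝ) :=
    (((hL _ hη0).and (hL' _ hη0)).filter_mono nhdsWithin_le_nhds).and self_mem_nhdsWithin
  obtain ⟨ε, ⟨hε1, hε2⟩, hε0⟩ := h3.exists
  have hε0' : ε ≠ 0 := hε0
  obtain ⟨δ, hδ1, hδ2⟩ := (hε1.and hε2).exists
  have hεpos : 0 < |ε| := abs_pos.2 hε0'
  have key : |ε| * |L - L'| ≤ |ε| * (|L - L'| / 2) := by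
    have : |ε * L - ε * L'| ≤ |L - L'| / 4 * |ε| + |L - L'| / 4 * |ε| := by
      calc |ε * L - ε * L'|
          = |(bondDomainCrossingProb (R.map (Φ ε)) δ - bondDomainCrossingProb (R.map (Φ 0)) δ - ε * L') -
              (bondDomainCrossingProb (R.map (Φ ε)) δ - bondDomainCrossingProb (R.map (Φ 0)) δ - ε * L)| := by
            ring_nf
        _ ≤ _ := abs_sub _ _
        _ ≤ _ := add_le_add hδ2 hδ1
    rw [← mul_sub, abs_mul] at this
    linarith
  have := le_of_mul_le_mul_left key hεpos
  linarith

/-- Uniqueness of the asymptotic first variation along an admissible field. [folklore] -/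
theorem eq_of_mem_hasVarSet {R : ConformalRectangle} {V : ℂ → ℂ} (hV : V ∈ niceSub) {L L' : ℝ}
    (hL : L ∈ hasVarSet R V) (hL' : L' ∈ hasVarSet R V) : L = L' := by
  obtain ⟨Φ, hΦ⟩ := exists_family hV
  exact eq_of_mem_aderivSet (hL Φ (mem_famSet_of_forall hΦ)) (hL' Φ (mem_famSet_of_forall hΦ))

/-- Homogeneity: reparametrising `ε ↦ ε / c` turns a `c • V`-family into a `V`-family. [folklore] -/
theorem smul_mem_hasVarSet {R : ConformalRectangle} {V : ℂ → ℂ} {L : ℝ} (hL : L ∈ hasVarSet R V) {c : ℝ}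
    (hc : c ≠ 0) : c * L ∈ hasVarSet R (c • V) := by
  intro Θ hΘ η hη
  have hΦ : (fun ε => Θ (ε / c)) ∈ famSet R V := by
    have ht : Tendsto (fun ε : ℝ => ε / c) (𝓝 0) (𝓝 0) := by
      simpa using (tendsto_id (x := 𝓝 (0:ℝ))).div_const c
    have h1 : ∀ᶠ ε in 𝓝 (0:ℝ), ∀ z ∈ closure R.carrier,
        Θ (ε / c) z = z + (((ε / c : ℝ)) : ℂ) * (c • V) z := ht.eventually hΘ
    filter_upwards [h1] with ε hε z hz
    rw [hε z hz, Pi.smul_apply, Complex.real_smul, Complex.ofReal_div]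
    have : (c : ℂ) ≠ 0 := Complex.ofReal_ne_zero.2 hc
    field_simp
  have h := hL _ hΦ (η / |c|) (div_pos hη (abs_pos.2 hc))
  have ht2 : Tendsto (fun ε : ℝ => c * ε) (𝓝 0) (𝓝 0) := by
    simpa using (tendsto_id (x := 𝓝 (0:ℝ))).const_mul c
  have h' := ht2.eventually h
  filter_upwards [h'] with ε hε
  filter_upwards [hε] with δ hδ
  simp only [mul_div_cancel_left₀ _ hc, zero_div] at hδ
  have hc' : 0 < |c| := abs_pos.2 hc
  calc |bondDomainCrossingProb (R.map (Θ ε)) δ - bondDomainCrossingProb (R.map (Θ 0)) δ - ε * (c * L)|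
      = |bondDomainCrossingProb (R.map (Θ ε)) δ - bondDomainCrossingProb (R.map (Θ 0)) δ - c * ε * L| := by
        ring_nf
    _ ≤ η / |c| * |c * ε| := hδ
    _ = η * |ε| := by rw [abs_mul]; field_simp

/-- The Lipschitz piece bounds the asymptotic first variation. [folklore] -/
theorem abs_le_of_mem_aderivSet {R : ConformalRectangle} {Φ : ℝ → ℂ ≃ₜ ℂ} {L C p : ℝ}
    (hL : L ∈ aderivSet R Φ)
    (hlip : ∀ᶠ ε in 𝓝 (0:ℝ), ∀ᶠ δ in 𝓝[>] (0:ℝ), |bondDomainCrossingProb (R.map (Φ ε)) δ -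
        bondDomainCrossingProb (R.map (Φ 0)) δ| ≤ C * |ε| * p) : |L| ≤ C * p := by
  refine le_of_forall_pos_lt_add fun η hη => ?_
  have hη2 : 0 < η / 2 := by positivity
  have h3 : ∀ᶠ ε in 𝓝[≠] (0:ℝ),
      ((∀ᶠ δ in 𝓝[>] (0:ℝ), |bondDomainCrossingProb (R.map (Φ ε)) δ -
          bondDomainCrossingProb (R.map (Φ 0)) δ - ε * L| ≤ η / 2 * |ε|) ∧
        (∀ᶠ δ in 𝓝[>] (0:ℝ), |bondDomainCrossingProb (R.map (Φ ε)) δ -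
          bondDomainCrossingProb (R.map (Φ 0)) δ| ≤ C * |ε| * p)) ∧ ε ∈ ({0}ᶜ : Set ℝ) :=
    (((hL _ hη2).and hlip).filter_mono nhdsWithin_le_nhds).and self_mem_nhdsWithin
  obtain ⟨ε, ⟨hε1, hε2⟩, hε0⟩ := h3.exists
  have hε0' : ε ≠ 0 := hε0
  obtain ⟨δ, hδ1, hδ2⟩ := (hε1.and hε2).exists
  have hεpos : 0 < |ε| := abs_pos.2 hε0'
  have key : |ε| * |L| ≤ |ε| * (η / 2 + C * p) := by
    have : |ε * L| ≤ η / 2 * |ε| + C * |ε| * p := by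
      calc |ε * L| = |(bondDomainCrossingProb (R.map (Φ ε)) δ - bondDomainCrossingProb (R.map (Φ 0)) δ) -
            (bondDomainCrossingProb (R.map (Φ ε)) δ - bondDomainCrossingProb (R.map (Φ 0)) δ - ε * L)| := by
            ring_nf
        _ ≤ _ := abs_sub _ _
        _ ≤ _ := add_le_add hδ2 hδ1
        _ = _ := by ring
    rw [abs_mul] at this
    linarith
  have := le_of_mul_le_mul_left key hεpos
  linarith

/-- Interchange of limits: an asymptotic (mesh-uniform) first variation along a family whose crossing
probabilities converge is the derivative of the crossing limit. [folklore] -/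
theorem hasDerivAt_of_mem_aderivSet {R : ConformalRectangle} {Φ : ℝ → ℂ ≃ₜ ℂ} {L : ℝ}
    (hL : L ∈ aderivSet R Φ)
    (hlim : ∀ᶠ ε in 𝓝 (0:ℝ), ∃ Λ : ℝ, Tendsto (bondDomainCrossingProb (R.map (Φ ε))) (𝓝[>] 0) (𝓝 Λ)) :
    HasDerivAt (fun ε => limUnder (𝓝[>] (0:ℝ)) (bondDomainCrossingProb (R.map (Φ ε)))) L 0 := by
  set f : ℝ → ℝ := fun ε => limUnder (𝓝[>] (0:ℝ)) (bondDomainCrossingProb (R.map (Φ ε))) with hf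
  have hconv : ∀ᶠ ε in 𝓝 (0:ℝ), Tendsto (bondDomainCrossingProb (R.map (Φ ε))) (𝓝[>] 0) (𝓝 (f ε)) :=
    hlim.mono fun ε hε => tendsto_nhds_limUnder hε
  have h0 : Tendsto (bondDomainCrossingProb (R.map (Φ 0))) (𝓝[>] 0) (𝓝 (f 0)) := hconv.self_of_nhds
  rw [hasDerivAt_iff_isLittleO, Asymptotics.isLittleO_iff]
  intro η hη
  filter_upwards [hL η hη, hconv] with ε hε hcε
  have ht : Tendsto (fun δ => bondDomainCrossingProb (R.map (Φ ε)) δ -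
      bondDomainCrossingProb (R.map (Φ 0)) δ - ε * L) (𝓝[>] 0) (𝓝 (f ε - f 0 - ε * L)) :=
    (hcε.sub h0).sub_const _
  have hle : |f ε - f 0 - ε * L| ≤ η * |ε| := le_of_tendsto ht.abs hε
  simpa [Real.norm_eq_abs, sub_zero, smul_eq_mul] using hle

/-! ### §4 Localisation: smooth partition of unity subordinate to `ρ`-balls -/

/-- An admissible field agrees, on any closed ball, with a finite sum of admissible fields each supported in a
ball of prescribed radius `ρ` (smooth partition of unity). [folklore] -/
theorem exists_local_sum {V : ℂ → ℂ} (hV : V ∈ niceSub) (r : ℝ) {ρ : ℝ} (hρ : 0 < ρ) :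
    ∃ (t : Finset ℂ) (W : ℂ → (ℂ → ℂ)), (∀ c ∈ t, W c ∈ niceSub) ∧ (∀ c ∈ t, tsupport (W c) ⊆ ball c ρ) ∧
      ∀ z ∈ closedBall (0:ℂ) r, ∑ c ∈ t, W c z = V z := by
  classical
  have hK : IsCompact (closedBall (0:ℂ) r) := isCompact_closedBall _ _
  obtain ⟨t, ht⟩ := hK.elim_finite_subcover (fun c : ℂ => ball c ρ) (fun _ => isOpen_ball)
    (fun z _ => mem_iUnion.2 ⟨z, mem_ball_self hρ⟩)
  -- a smooth partition of unity on the closed ball subordinate to the finite subcover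
  have hcov : closedBall (0:ℂ) r ⊆ ⋃ i : t, ball (i:ℂ) ρ := by
    intro z hz
    obtain ⟨c, hc, hz'⟩ := mem_iUnion₂.1 (ht hz)
    exact mem_iUnion.2 ⟨⟨c, hc⟩, hz'⟩
  obtain ⟨f, hf⟩ := SmoothPartitionOfUnity.exists_isSubordinate 𝓘(ℝ, ℂ) isClosed_closedBall
    (fun i : t => ball (i:ℂ) ρ) (fun _ => isOpen_ball) hcov
  obtain ⟨hV1, B, hB⟩ := hV
  -- the pieces
  let W : ℂ → (ℂ → ℂ) := fun c z => if h : c ∈ t then (f ⟨c, h⟩ z) • V z else 0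
  have hWc : ∀ c (h : c ∈ t), W c = fun z => (f ⟨c, h⟩ z) • V z := fun c h => by
    funext z; simp only [W, dif_pos h]
  have hfs : ∀ i : t, ContDiff ℝ ∞ (f i : ℂ → ℝ) := fun i => contMDiff_iff_contDiff.1 (f i).contMDiff
  have hsupp : ∀ c (h : c ∈ t), tsupport (W c) ⊆ ball c ρ := fun c h => by
    rw [hWc c h]
    exact (tsupport_smul_subset_left _ _).trans (hf ⟨c, h⟩)
  have hcpt : ∀ c (h : c ∈ t), HasCompactSupport (W c) := fun c h =>
    IsCompact.of_isClosed_subset (isCompact_closedBall c ρ) (isClosed_tsupport _)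
      ((hsupp c h).trans ball_subset_closedBall)
  refine ⟨t, W, fun c hc => ?_, fun c hc => hsupp c hc, fun z hz => ?_⟩
  · -- admissibility of each piece: `C²`, compactly supported
    have h2 : ContDiff ℝ 2 (W c) := by
      rw [hWc c hc]
      exact ((hfs ⟨c, hc⟩).of_le (by norm_cast)).smul hV1
    have hcont : Continuous (W c) := h2.continuous
    have hdcont : Continuous (fderiv ℝ (W c)) := h2.continuous_fderiv (by norm_num)
    obtain ⟨C₁, hC₁⟩ := hcont.bounded_above_of_compact_support (hcpt c hc)
    obtain ⟨C₂, hC₂⟩ := hdcont.bounded_above_of_compact_support ((hcpt c hc).fderiv (𝕜 := ℝ))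
    have hC₁0 : 0 ≤ C₁ := (norm_nonneg _).trans (hC₁ 0)
    refine ⟨h2, max C₁ C₂, fun z => ⟨?_, (hC₂ z).trans (le_max_right _ _)⟩⟩
    calc ‖W c z‖ ≤ C₁ := hC₁ z
      _ ≤ max C₁ C₂ := le_max_left _ _
      _ ≤ max C₁ C₂ * (1 + ‖z‖) :=
        le_mul_of_one_le_right (hC₁0.trans (le_max_left _ _)) (by linarith [norm_nonneg z])
  · -- the pieces sum to `V` on the closed ball
    have h1 : ∑ c ∈ t, W c z = ∑ i : t, (f i z) • V z := by
      rw [← Finset.sum_coe_sort]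
      refine Finset.sum_congr rfl fun i _ => ?_
      rw [hWc i i.2]
    rw [h1, ← Finset.sum_smul, ← finsum_eq_sum_of_fintype, f.sum_eq_one hz, one_smul]

/-! ### §5 The assembly -/

/-- **Composition lemma** (kernel-checked, sorry-free): the four stub statements, written out verbatim, imply the
BODY of `HadamardRegularity` (verbatim). The by-name skeleton theorem `HadamardRegularity_of` below applies it to the
four stubs; the Theorems-packaged copy `hadamardRegularity_of_subs` (candidate proof attached to the item) concludes
the crux by name. [folklore] -/
theorem hadamardRegularity_of_pieces :
    (open Literature.Probability.Percolation Literature.Probability.LatticeModels Literature.Probability.RandomPlanarGeometry in ∀ R : ConformalRectangle, ∃ C r : ℝ, closure R.carrier ⊆ Metric.ball (0:ℂ) r ∧ ∀ V : ℂ → ℂ, ContDiff ℝ 2 V → (∃ B : ℝ, ∀ z : ℂ, ‖V z‖ ≤ B * (1 + ‖z‖) ∧ ‖fderiv ℝ V z‖ ≤ B) → ∀ Φ : ℝ → ℂ ≃ₜ ℂ, (∀ᶠ ε in 𝓝 (0:ℝ), ∀ z ∈ closure R.carrier, Φ ε z = z + (ε : ℂ) * V z) → ∀ᶠ ε in 𝓝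 (0:ℝ), ∀ᶠ δ in 𝓝[>] (0:ℝ), |bondDomainCrossingProb (R.map (Φ ε)) δ - bondDomainCrossingProb (R.map (Φ 0)) δ| ≤ C * |ε| * sSup ((fun z : ℂ => ‖V z‖ + ‖fderiv ℝ V z‖) '' Metric.closedBall (0:ℂ) r)) →
    (open Literature.Probability.Percolation Literature.Probability.LatticeModels Literature.Probability.RandomPlanarGeometry in ∀ R : ConformalRectangle, ∃ ρ : ℝ, 0 < ρ ∧ ∀ (z₀ : ℂ) (V : ℂ → ℂ), ContDiff ℝ 2 V → (∃ B : ℝ, ∀ z : ℂ, ‖V z‖ ≤ B * (1 + ‖z‖) ∧ ‖fderiv ℝ V z‖ ≤ B) → tsupport V ⊆ Metric.ball z₀ ρ → ∃ L : ℝ, ∀ Φ : ℝ → ℂ ≃ₜ ℂ, (∀ᶠ ε in 𝓝 (0:ℝ), ∀ z ∈ closure R.carrier, Φ ε z = z + (ε : ℂ) * V z) → ∀ η : ℝ, 0 < η → ∀ᶠ ε in 𝓝 (0:ℝ), ∀ᶠ δ in 𝓝[>] (0:ℝ), |bondDomainCrossingProb (R.map (Φ ε)) δ - bondDomainCrossingProb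 (R.map (Φ 0)) δ - ε * L| ≤ η * |ε|) →
    (open Literature.Probability.Percolation Literature.Probability.LatticeModels Literature.Probability.RandomPlanarGeometry in ∀ (R : ConformalRectangle) (V W : ℂ → ℂ) (L M : ℝ), ContDiff ℝ 2 V → (∃ B : ℝ, ∀ z : ℂ, ‖V z‖ ≤ B * (1 + ‖z‖) ∧ ‖fderiv ℝ V z‖ ≤ B) → ContDiff ℝ 2 W → (∃ B : ℝ, ∀ z : ℂ, ‖W z‖ ≤ B * (1 + ‖z‖) ∧ ‖fderiv ℝ W z‖ ≤ B) → (∀ Φ : ℝ → ℂ ≃ₜ ℂ, (∀ᶠ ε in 𝓝 (0:ℝ), ∀ z ∈ closure R.carrier, Φ ε z = z + (ε : ℂ) * V z) → ∀ η : ℝ, 0 < η → ∀ᶠ ε in 𝓝 (0:ℝ), ∀ᶠ δ in 𝓝[>] (0:ℝ), |bondDomainCrossingProb (R.map (Φ ε)) δ - bondDomainCrossingProb (R.map (Φ 0)) δ - ε * L| ≤ η * |ε|) → (∀ Φ : ℝ → ℂ ≃ₜ ℂ, (∀ᶠ ε in 𝓝 (0:ℝ), ∀ z ∈ closure R.carrier,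 Φ ε z = z + (ε : ℂ) * W z) → ∀ η : ℝ, 0 < η → ∀ᶠ ε in 𝓝 (0:ℝ), ∀ᶠ δ in 𝓝[>] (0:ℝ), |bondDomainCrossingProb (R.map (Φ ε)) δ - bondDomainCrossingProb (R.map (Φ 0)) δ - ε * M| ≤ η * |ε|) → ∀ Φ : ℝ → ℂ ≃ₜ ℂ, (∀ᶠ ε in 𝓝 (0:ℝ), ∀ z ∈ closure R.carrier, Φ ε z = z + (ε : ℂ) * (V z + W z)) → ∀ η : ℝ, 0 < η → ∀ᶠ ε in 𝓝 (0:ℝ), ∀ᶠ δ in 𝓝[>] (0:ℝ), |bondDomainCrossingProb (R.map (Φ ε)) δ - bondDomainCrossingProb (R.map (Φ 0)) δ - ε * (L + M)| ≤ η * |ε|) →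
    (open Literature.Probability.Percolation Literature.Probability.LatticeModels Literature.Probability.RandomPlanarGeometry in ∀ (R : ConformalRectangle) (V : ℂ → ℂ), ContDiff ℝ 2 V → (∃ B : ℝ, ∀ z : ℂ, ‖V z‖ ≤ B * (1 + ‖z‖) ∧ ‖fderiv ℝ V z‖ ≤ B) → ∀ Φ : ℝ → ℂ ≃ₜ ℂ, (∀ᶠ ε in 𝓝 (0:ℝ), ∀ z ∈ closure R.carrier, Φ ε z = z + (ε : ℂ) * V z) → ∀ᶠ ε in 𝓝 (0:ℝ), ∃ Λ : ℝ, Tendsto (bondDomainCrossingProb (R.map (Φ ε))) (𝓝[>] 0) (𝓝 Λ)) →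
    (open Literature.Probability.Percolation Literature.Probability.LatticeModels Literature.Probability.RandomPlanarGeometry in ∀ R : ConformalRectangle, ∃ (D' : (ℂ → ℂ) →ₗ[ℝ] ℝ) (C r : ℝ), closure R.carrier ⊆ Metric.ball (0:ℂ) r ∧ ∀ V : ℂ → ℂ, ContDiff ℝ 2 V → (∃ B : ℝ, ∀ z : ℂ, ‖V z‖ ≤ B * (1 + ‖z‖) ∧ ‖fderiv ℝ V z‖ ≤ B) → |D' V| ≤ C * sSup ((fun z : ℂ => ‖V z‖ + ‖fderiv ℝ V z‖) '' Metric.closedBall (0:ℂ) r) ∧ ∀ Φ : ℝ → ℂ ≃ₜ ℂ, (∀ᶠ ε in 𝓝 (0:ℝ), ∀ z : ℂ, Φ ε z = z + (ε : ℂ) * V z) → HasDerivAt (fun ε : ℝ => limUnder (𝓝[>] (0:ℝ)) (bondDomainCrossingProb (R.map (Φ ε)))) (D' V) 0) := by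
  intro hLip hLoc hAdd hLim
  classical
  intro R
  obtain ⟨C, r, hRr, hLipR⟩ := hLip R
  obtain ⟨ρ, hρ, hLocR⟩ := hLoc R
  -- (1) every admissible field localised in a `ρ`-ball has an asymptotic first variation
  have hloc : ∀ (z₀ : ℂ) (V : ℂ → ℂ), V ∈ niceSub → tsupport V ⊆ ball z₀ ρ → ∃ L, L ∈ hasVarSet R V :=
    fun z₀ V hV hsupp => hLocR z₀ V hV.1 hV.2 hsupp
  -- (2) superposition
  have hadd : ∀ (V W : ℂ → ℂ), V ∈ niceSub → W ∈ niceSub → ∀ (L M : ℝ), L ∈ hasVarSet R V →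
      M ∈ hasVarSet R W → L + M ∈ hasVarSet R (V + W) :=
    fun V W hV hW L M hL hM => hAdd R V W L M hV.1 hV.2 hW.1 hW.2 hL hM
  -- (3) existence for every admissible field: localise on the closed ball of radius `r` ⊇ `R̄`, glue by (2)
  have hex : ∀ V : ℂ → ℂ, V ∈ niceSub → ∃ L, L ∈ hasVarSet R V := by
    intro V hV
    obtain ⟨t, W, hWn, hWs, hsum⟩ := exists_local_sum hV r hρ
    -- induction over the finite sum
    have hind : ∀ s : Finset ℂ, s ⊆ t → (∑ c ∈ s, W c) ∈ niceSub ∧ ∃ L, L ∈ hasVarSet R (∑ c ∈ s, W c) := by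
      intro s
      induction s using Finset.induction_on with
      | empty =>
        intro _
        simp only [Finset.sum_empty]
        exact ⟨niceSub.zero_mem, 0, zero_mem_hasVarSet R⟩
      | insert a s ha ih =>
        intro hst
        obtain ⟨hsn, Ls, hLs⟩ := ih ((Finset.subset_insert a s).trans hst)
        have hat : a ∈ t := hst (Finset.mem_insert_self a s)
        obtain ⟨La, hLa⟩ := hloc a (W a) (hWn a hat) (hWs a hat)
        rw [Finset.sum_insert ha]
        exact ⟨niceSub.add_mem (hWn a hat) hsn, La + Ls, hadd _ _ (hWn a hat) hsn _ _ hLa hLs⟩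
    obtain ⟨-, L, hL⟩ := hind t le_rfl
    refine ⟨L, fun Φ hΦ => hL Φ ?_⟩
    -- `Φ` is also a family for the glued field, which agrees with `V` on `R̄ ⊆ closedBall 0 r`
    filter_upwards [hΦ] with ε hε z hz
    rw [hε z hz, Finset.sum_apply, hsum z (ball_subset_closedBall (hRr hz))]
  -- (4) the derivative functional on the admissible fields, and its linearity
  have huniq : ∀ V : ℂ → ℂ, V ∈ niceSub → ∀ L L' : ℝ, L ∈ hasVarSet R V → L' ∈ hasVarSet R V → L = L' :=
    fun V hV L L' hL hL' => eq_of_mem_hasVarSet hV hL hL'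
  let D₀f : niceSub → ℝ := fun V => (hex V V.2).choose
  have hD₀f : ∀ V : niceSub, D₀f V ∈ hasVarSet R V := fun V => (hex V V.2).choose_spec
  let D₀ : niceSub →ₗ[ℝ] ℝ :=
    { toFun := D₀f
      map_add' := fun V W =>
        huniq _ (V + W).2 _ _ (hD₀f (V + W)) (hadd _ _ V.2 W.2 _ _ (hD₀f V) (hD₀f W))
      map_smul' := fun c V => by
        by_cases hc : c = 0
        · subst hc
          simp only [zero_smul, RingHom.id_apply]
          exact huniq _ niceSub.zero_mem _ _ (hD₀f 0) (zero_mem_hasVarSet R)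
        · exact huniq _ (c • V).2 _ _ (hD₀f (c • V)) (smul_mem_hasVarSet (hD₀f V) hc) }
  obtain ⟨D', hD'⟩ := LinearMap.exists_extend D₀
  have hD'eq : ∀ (V : ℂ → ℂ) (hV : V ∈ niceSub), D' V = D₀ ⟨V, hV⟩ := fun V hV => by
    have := LinearMap.congr_fun hD' ⟨V, hV⟩
    simpa using this
  -- (5) conclusion
  refine ⟨D', C, r, hRr, fun V hV1 hV2 => ?_⟩
  have hV : V ∈ niceSub := ⟨hV1, hV2⟩
  have hDV : D' V ∈ hasVarSet R V := by rw [hD'eq V hV]; exact hD₀f ⟨V, hV⟩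
  refine ⟨?_, fun Φ hΦ => ?_⟩
  · -- the `C¹` bound, from the Lipschitz piece along the standard family
    obtain ⟨Φ, hΦ⟩ := exists_family hV
    have hΦ' : Φ ∈ famSet R V := mem_famSet_of_forall hΦ
    exact abs_le_of_mem_aderivSet (hDV Φ hΦ') (hLipR V hV1 hV2 Φ hΦ')
  · -- differentiability of the crossing limit along the given family
    have hΦ' : Φ ∈ famSet R V := mem_famSet_of_forall hΦ
    exact hasDerivAt_of_mem_aderivSet (hDV Φ hΦ') (hLim R V hV1 hV2 Φ hΦ')

/-- **The line closes the crux modulo its four stubs** (the crux BY NAME): the composition lemma applied to the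
stubs (depends on the four `sorry`s above, nothing else). [folklore] -/
theorem HadamardRegularity_of :
    Summit.CriticalPhenomena.CardyFormulaZ2.Theses.CardyStressTensorWard.HadamardRegularity :=
  hadamardRegularity_of_pieces stub_deformationLipschitz stub_localizedVariation stub_variationSuperposition
    stub_deformationLimits

end Summit.CriticalPhenomena.CardyFormulaZ2.Cruxes.HadamardRegularity.HadamardSplit

end
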